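import Literature.Computability.MetaComplexity.AvgHardTables
import Literature.Computability.MetaComplexity.NWTableGenerator
import Literature.Computability.Complexity.FoldBricks
import HarnessLib

/-!
# The tables with a good small approximator form an `NP` language (`ApproxTables 2^{⌊ℓ/8⌋} ∈ NP`)

Topic `Literature/Computability/MetaComplexity`, sibling of `AvgHardTables.lean` (Köbler–Schuler
certified AVERAGE-case hardness under `coNP × {U} ⊆ Avg¹_{1-n^{-c}} P`; Hirahara, ECCC TR21-058,
Lemma 3.4, proof sketch, item 2). The certifier of that file (`exists_avgCertifier_eighthExp`) needs the
`coNP`-ness of "`H_avg(f) ≥ 2^{⌊ℓ/8⌋}`", i.e. `ApproxTables eighthExp ∈ NP`: a table is approximable iff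
SOME `B₂`-circuit of size `≤ 2^{⌊ℓ/8⌋}` agrees with it on `≥ (1/2 + 2^{-⌊ℓ/8⌋}) 2^ℓ` inputs — guess the
circuit, evaluate it on all `2^ℓ` points, count the agreements (the guess-and-check observation behind
`MCSP ∈ NP`, Kabanets–Cai 2000, §2, with a count in place of "all rows agree").

The verifier is assembled from the bricks of `MCSP ∈ NP` (`MCSPProofs.lean`, namespace `MCSPVerif`:
the conditions `POW` (`|tt| = 2ⁿ`), `CLEAN` (the certificate's program parses), `SIZE` (`#TAB D ≤ s`),
the circuit-evaluation machine `CircEval.evalFn` and Theorem R `exists_circuit_evalFn`), reached through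
the lift `z = ⟨tt, ⟨1ⁿ, D⟩⟩ ↦ ⟨⟨tt, bin 2^{⌊n/8⌋}⟩, ⟨1ⁿ, D⟩⟩` (`liftF`), plus one new condition:

* `COUNT` — `2ⁿ (S + 2) ≤ 2 S A`, `S = 2^{⌊n/8⌋}`, `A = #{i < |tt| : tt[i] = D(point i)}` computed by the
  counted fold `Brick.foldLoop addFn` (`FoldBricks.lean`) of the one-symbol pieces
  `[tt[i] = evalFn ⟨lowBits n i, D⟩]` (`pieceC`, `accF`, `accF_apply`), the two sides as numerals built
  from zero strings (`2ᵏ = 0ᵏ1`, `S · A = 0^{⌊n/8⌋} A`) and compared by `ltFn`;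
* `ApproxVerif.Ver = POW' ⊓ CLEAN' ⊓ SIZE' ⊓ COUNT ∈ P` (`Ver_mem_P`), `sound`, `complete` (certificate
  `⟨1ⁿ, progOf C⟩` of length `≤ wlen |tt|`), and **`ApproxTables_eighthExp_mem_NP`**.

Everything is proved; definitions are verifier bricks (proof devices). Nothing duplicates the tree
(searched `ApproxTables`, `agreement count`, `MCSPVerif`: reused, not copied).

## References

* S. Hirahara, ECCC TR21-058 (2021), Lemma 3.4, proof sketch, item 2 (p. 20) [Hirahara2021].
* V. Kabanets, J.-Y. Cai, *Circuit minimization problem*, STOC 2000, §2 (`MCSP ∈ NP`) [KabanetsCai2000].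
* C. D. Murray, R. R. Williams, CCC 2015, §1 p. 365 (the guess-and-check verifier).
* S. Arora, B. Barak, *Computational Complexity: A Modern Approach*, CUP 2009, Def. 2.1, Def. 19.1
  [AroraBarakCC2009].
-/

noncomputable section

namespace Literature.Computability.MetaComplexity

open _root_.Computability Polynomial Complexity Complexity.Classes Complexity.Nondeterministic Complexity.CircEval
  Complexity.Brick Finset
open MCSPVerif AvgHardTables

namespace ApproxVerif

/-! ### Arithmetic of numerals -/

/-- Dropping `k` low-order bits divides the value by `2ᵏ`. [folklore] -/
theorem bitsToNat_drop : ∀ (k : ℕ) (w : List Bool), bitsToNat (w.drop k) = bitsToNat w / 2 ^ k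
  | 0, w => by simp
  | k + 1, [] => by simp
  | k + 1, b :: w => by
    rw [List.drop_succ_cons, bitsToNat_drop k w, bitsToNat_cons, pow_succ', ← Nat.div_div_eq_div_mul]
    congr 1
    have hb : b.toNat ≤ 1 := Bool.toNat_le b
    omega

/-! ### Pointwise `FP` closure

The pointwise forms `NWTable.NWTable.pairF_mem_FP` / `NWTable.NWTable.compF_mem_FP` (`NWTableGenerator.lean`) and
`append_mem_FP` (`FPStringBricks.lean`) are used for bricks written as lambdas. -/

/-! ### The parameters read off `z = ⟨tt, ⟨1ⁿ, D⟩⟩` -/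

/-- `1^{⌊n/8⌋}`, `n = |fstP (sndP z)|`: the numeral `bin n` with three low bits dropped, converted back
to unary on the ruler `1ⁿ`. [folklore] -/
def n8F : List Bool → List Bool := fun z =>
  binToUnaryFn (boolPair (fstP (sndP z))
    (sndP (dropSndFn (Polynomial.C 3) (boolPair [] (unToBinFn (fstP (sndP z)))))))

/-- `n8F ∈ FP`. [folklore] -/
theorem n8F_mem_FP : n8F ∈ FP := by
  have h1 : (fun z => fstP (sndP z)) ∈ FP := NWTable.compF_mem_FP (g := fstP) fstP_mem_FP sndP_mem_FP
  have h2 : (fun z => boolPair ([] : List Bool) (unToBinFn (fstP (sndP z)))) ∈ FP :=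
    NWTable.pairF_mem_FP (const_mem_FP _) (NWTable.compF_mem_FP (g := unToBinFn) unToBinFn_mem_FP h1)
  have h3 : (fun z => sndP (dropSndFn (Polynomial.C 3) (boolPair [] (unToBinFn (fstP (sndP z)))))) ∈ FP :=
    NWTable.compF_mem_FP (g := sndP) sndP_mem_FP (NWTable.compF_mem_FP (g := dropSndFn (Polynomial.C 3)) (dropSndFn_mem_FP _) h2)
  exact NWTable.compF_mem_FP (g := binToUnaryFn) binToUnaryFn_mem_FP (NWTable.pairF_mem_FP h1 h3)

/-- Value of `n8F` on `⟨tt, y⟩`: `1^{⌊n/8⌋}`, `n = |fstP y|`. [folklore] -/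
theorem n8F_apply (tt y : List Bool) : n8F (boolPair tt y) = ones ((fstP y).length / 8) := by
  unfold n8F
  rw [sndP_boolPair, unToBinFn_apply, dropSndFn_boolPair, sndP_boolPair, binToUnaryFn_boolPair, eval_C,
    bitsToNat_drop, bitsToNat_encodeNat, show (2 : ℕ) ^ 3 = 8 by norm_num,
    min_eq_left (Nat.div_le_self _ _)]

/-- The size numeral `bin 2^{⌊n/8⌋} = 0^{⌊n/8⌋} 1`. [folklore] -/
def sNumF : List Bool → List Bool := fun z => Kannan.zerosFn (n8F z) ++ [true]

/-- `sNumF ∈ FP`. [folklore] -/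
theorem sNumF_mem_FP : sNumF ∈ FP :=
  append_mem_FP (NWTable.compF_mem_FP (g := Kannan.zerosFn) Kannan.zerosFn_mem_FP n8F_mem_FP) (const_mem_FP _)

/-- Value of `sNumF`. [folklore] -/
theorem sNumF_apply (tt y : List Bool) : sNumF (boolPair tt y) = encodeNat (2 ^ ((fstP y).length / 8)) := by
  unfold sNumF
  rw [n8F_apply, Kannan.zerosFn_apply, Com.encodeNat_two_pow]
  simp [ones]

/-- **The lift to the instance format of `MCSPVerif`**: `⟨tt, y⟩ ↦ ⟨⟨tt, bin 2^{⌊n/8⌋}⟩, y⟩`. [folklore] -/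
def liftF : List Bool → List Bool := fun z => boolPair (boolPair (fstP z) (sNumF z)) (sndP z)

/-- `liftF ∈ FP`. [folklore] -/
theorem liftF_mem_FP : liftF ∈ FP :=
  NWTable.pairF_mem_FP (NWTable.pairF_mem_FP fstP_mem_FP sNumF_mem_FP) sndP_mem_FP

/-- Value of the lift. [folklore] -/
theorem liftF_apply (tt y : List Bool) :
    liftF (boolPair tt y) = boolPair (boolPair tt (encodeNat (2 ^ ((fstP y).length / 8)))) y := by
  unfold liftF
  rw [fstP_boolPair, sndP_boolPair, sNumF_apply]

/-! ### The lifted conditions `POW'`, `CLEAN'`, `SIZE'` -/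

/-- `POW'`: `|tt| = 2ⁿ`. [folklore] -/
def POW' : Language Bool := liftF ⁻¹' POW

/-- `CLEAN'`: the program parses. [folklore] -/
def CLEAN' : Language Bool := liftF ⁻¹' CLEAN

/-- `SIZE'`: `#TAB D ≤ 2^{⌊n/8⌋}`. [folklore] -/
def SIZE' : Language Bool := liftF ⁻¹' SIZE

/-- `POW' ∈ P`. [folklore] -/
theorem POW'_mem_P : POW' ∈ P := preimage_mem_P POW_mem_P liftF_mem_FP

/-- `CLEAN' ∈ P`. [folklore] -/
theorem CLEAN'_mem_P : CLEAN' ∈ P := preimage_mem_P CLEAN_mem_P liftF_mem_FP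

/-- `SIZE' ∈ P`. [folklore] -/
theorem SIZE'_mem_P : SIZE' ∈ P := preimage_mem_P SIZE_mem_P liftF_mem_FP

/-- Reading `POW'`. [folklore] -/
theorem mem_POW'_iff (tt y : List Bool) : boolPair tt y ∈ POW' ↔ tt.length = 2 ^ (fstP y).length := by
  rw [POW', memL_preimage, liftF_apply, mem_POW_iff]

/-- Reading `CLEAN'`. [folklore] -/
theorem mem_CLEAN'_iff (tt y : List Bool) : boolPair tt y ∈ CLEAN' ↔ isClean (sndP y) = true := by
  rw [CLEAN', memL_preimage, liftF_apply, mem_CLEAN_iff]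

/-- Reading `SIZE'`. [folklore] -/
theorem mem_SIZE'_iff (tt y : List Bool) :
    boolPair tt y ∈ SIZE' ↔ tabCount (sndP y) ≤ 2 ^ ((fstP y).length / 8) := by
  rw [SIZE', memL_preimage, liftF_apply, mem_SIZE_iff _ _ _ (2 ^ ((fstP y).length / 8)) rfl]
  exact ⟨fun h => h.1, fun h => ⟨h, (Nat.two_pow_pos _).ne'⟩⟩

/-! ### The agreement count -/

/-- On a row `w = ⟨z, 1ⁱ⟩`, `z = ⟨tt, ⟨1ⁿ, D⟩⟩`: the bit `tt[i]` (`[]` past the end). [folklore] -/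
def bitC : List Bool → List Bool := fun w => bitAtFn (boolPair (sndP w) (fstP (fstP w)))

/-- On a row: the point `lowBits n i` as an `n`-bit string. [folklore] -/
def argC : List Bool → List Bool := fun w =>
  fstP (padTakeFn (boolPair (fstP (sndP (fstP w))) (unToBinFn (sndP w))))

/-- On a row: the evaluator's answer on `⟨point i, D⟩`. [cite: AroraBarakCC2009, Thm. 6.18 (proof)] -/
def ansC : List Bool → List Bool := fun w => evalFn (boolPair (argC w) (sndP (sndP (fstP w))))

/-- **The piece of row `i`**: the one-symbol numeral `[tt[i] = D(point i)]`. [folklore] -/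
def pieceC : List Bool → List Bool := fun w => eqPairFn (boolPair (bitC w) (ansC w))

/-- `pieceC ∈ FP`. [folklore] -/
theorem pieceC_mem_FP : pieceC ∈ FP := by
  have hbit : bitC ∈ FP :=
    NWTable.compF_mem_FP (g := bitAtFn) bitAtFn_mem_FP
      (NWTable.pairF_mem_FP sndP_mem_FP (NWTable.compF_mem_FP (g := fstP) fstP_mem_FP fstP_mem_FP))
  have harg : argC ∈ FP :=
    NWTable.compF_mem_FP (g := fstP) fstP_mem_FP (NWTable.compF_mem_FP (g := padTakeFn) padTakeFn_mem_FP
      (NWTable.pairF_mem_FP (NWTable.compF_mem_FP (g := fstP) fstP_mem_FP (NWTable.compF_mem_FP (g := sndP) sndP_mem_FP fstP_mem_FP))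
        (NWTable.compF_mem_FP (g := unToBinFn) unToBinFn_mem_FP sndP_mem_FP)))
  have hans : ansC ∈ FP :=
    NWTable.compF_mem_FP (g := evalFn) evalFn_mem_FP
      (NWTable.pairF_mem_FP harg (NWTable.compF_mem_FP (g := sndP) sndP_mem_FP (NWTable.compF_mem_FP (g := sndP) sndP_mem_FP fstP_mem_FP)))
  exact NWTable.compF_mem_FP (g := eqPairFn) eqPairFn_mem_FP (NWTable.pairF_mem_FP hbit hans)

/-- **Value of the piece of row `i`.** [folklore] -/
theorem pieceC_apply (tt y : List Bool) (i : ℕ) :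
    pieceC (boolPair (boolPair tt y) (ones i)) =
      [decide ((tt.drop i).take 1 = evalFn (boolPair (List.ofFn (lowBits (fstP y).length i)) (sndP y)))] := by
  unfold pieceC bitC ansC argC
  simp only [fstP_boolPair, sndP_boolPair, bitAtFn_boolPair, unToBinFn_apply, padTakeFn_boolPair, takeD_encodeNat,
    eqPairFn_boolPair]
  simp [ones]

/-- The piece is one symbol long on every input. [folklore] -/
theorem length_pieceC (w : List Bool) : (pieceC w).length = 1 := by
  unfold pieceC
  rw [eqPairFn_boolPair, List.length_singleton]

/-- **The number of agreements**, as a canonical numeral: the counted fold `foldLoop addFn` of the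
pieces over `i < |tt|`. [folklore] -/
def accF : List Bool → List Bool := fun z =>
  sndPow 2 (foldLoop addFn (clipF 1 pieceC) X (boolPair z (boolPair (lenBinF (fstP z)) (boolPair [] []))))

/-- `accF ∈ FP`. [folklore] -/
theorem accF_mem_FP : accF ∈ FP :=
  NWTable.compF_mem_FP (g := sndPow 2) (sndPow_mem_FP 2)
    (NWTable.compF_mem_FP (g := foldLoop addFn (clipF 1 pieceC) X)
      (foldLoop_clipF_mem_FP 1 addFn_mem_FP length_addFn_le pieceC_mem_FP _)
      (NWTable.pairF_mem_FP (PolyTimeComputable.id _)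
        (NWTable.pairF_mem_FP (NWTable.compF_mem_FP (g := lenBinF) lenBinF_mem_FP fstP_mem_FP) (const_mem_FP _))))

/-- **The agreement count** of `⟨tt, y⟩`: the number of `i < |tt|` with `tt[i] = D(point i)`. [folklore] -/
def accCount (tt y : List Bool) : ℕ :=
  ∑ i ∈ Finset.range tt.length,
    (decide ((tt.drop i).take 1 = evalFn (boolPair (List.ofFn (lowBits (fstP y).length i)) (sndP y)))).toNat

/-- **Value of `accF`.** [folklore] -/
theorem accF_apply (tt y : List Bool) : accF (boolPair tt y) = encodeNat (accCount tt y) := by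
  have hk : tt.length ≤ X.eval (boolPair tt y).length := by
    simp only [eval_X, length_boolPair]; omega
  unfold accF
  rw [fstP_boolPair, lenBinF_apply, show boolPair ([] : List Bool) [] = boolPair (ones 0) (encodeNat 0) by rfl,
    foldLoop_apply addFn _ hk 0 (encodeNat 0), sndPow_succ_boolPair, sndPow_succ_boolPair, sndPow_zero_boolPair,
    foldAcc_clipF (fun j _ _ => by rw [length_pieceC]; omega), foldAcc_addFn]
  have hb : ∀ b : Bool, bitsToNat [b] = b.toNat := fun b => by rw [bitsToNat_cons]; simp
  simp only [zero_add, accCount, pieceC_apply, hb]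

/-! ### The threshold condition `COUNT`: `2ⁿ (S + 2) ≤ 2 S A`, `S = 2^{⌊n/8⌋}` -/

/-- The left side `2^{n + ⌊n/8⌋} + 2^{n+1} = 2ⁿ (S + 2)` as a numeral. [folklore] -/
def lhsF : List Bool → List Bool := fun z =>
  addFn (boolPair (Kannan.zerosFn (fstP (sndP z) ++ n8F z) ++ [true]) (Kannan.zerosFn (true :: fstP (sndP z)) ++ [true]))

/-- The right side `2 S A` as a numeral (`S A = 0^{⌊n/8⌋} A`, doubled by `addFn`). [folklore] -/
def rhsF : List Bool → List Bool := fun z =>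
  addFn (boolPair (Kannan.zerosFn (n8F z) ++ accF z) (Kannan.zerosFn (n8F z) ++ accF z))

/-- The comparison bit `[2 S A < 2ⁿ (S + 2)]`. [folklore] -/
def cmpF : List Bool → List Bool := fun z => ltFn (boolPair (rhsF z) (lhsF z))

/-- `lhsF ∈ FP`. [folklore] -/
theorem lhsF_mem_FP : lhsF ∈ FP := by
  have h1 : (fun z => fstP (sndP z)) ∈ FP := NWTable.compF_mem_FP (g := fstP) fstP_mem_FP sndP_mem_FP
  have h2 : (fun z => Kannan.zerosFn (fstP (sndP z) ++ n8F z) ++ [true]) ∈ FP :=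
    append_mem_FP (NWTable.compF_mem_FP (g := Kannan.zerosFn) Kannan.zerosFn_mem_FP (append_mem_FP h1 n8F_mem_FP)) (const_mem_FP _)
  have h3 : (fun z => Kannan.zerosFn (true :: fstP (sndP z)) ++ [true]) ∈ FP :=
    append_mem_FP (NWTable.compF_mem_FP (g := Kannan.zerosFn) Kannan.zerosFn_mem_FP (NWTable.compF_mem_FP (g := List.cons true) (cons_mem_FP true) h1))
      (const_mem_FP _)
  exact NWTable.compF_mem_FP (g := addFn) addFn_mem_FP (NWTable.pairF_mem_FP h2 h3)

/-- `rhsF ∈ FP`. [folklore] -/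
theorem rhsF_mem_FP : rhsF ∈ FP := by
  have h1 : (fun z => Kannan.zerosFn (n8F z) ++ accF z) ∈ FP :=
    append_mem_FP (NWTable.compF_mem_FP (g := Kannan.zerosFn) Kannan.zerosFn_mem_FP n8F_mem_FP) accF_mem_FP
  exact NWTable.compF_mem_FP (g := addFn) addFn_mem_FP (NWTable.pairF_mem_FP h1 h1)

/-- `cmpF ∈ FP`. [folklore] -/
theorem cmpF_mem_FP : cmpF ∈ FP := NWTable.compF_mem_FP (g := ltFn) ltFn_mem_FP (NWTable.pairF_mem_FP rhsF_mem_FP lhsF_mem_FP)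

/-- Value of the left side: `2ⁿ (2^{⌊n/8⌋} + 2)`. [folklore] -/
theorem bitsToNat_lhsF (tt y : List Bool) :
    bitsToNat (lhsF (boolPair tt y)) = 2 ^ (fstP y).length * (2 ^ ((fstP y).length / 8) + 2) := by
  unfold lhsF
  rw [sndP_boolPair, n8F_apply, addFn_boolPair, bitsToNat_encodeNat, Kannan.zerosFn_apply, Kannan.zerosFn_apply,
    ← Com.encodeNat_two_pow, ← Com.encodeNat_two_pow, bitsToNat_encodeNat, bitsToNat_encodeNat, List.length_append,
    List.length_cons]
  simp only [ones, List.length_replicate]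
  ring

/-- Value of the right side: `2 · 2^{⌊n/8⌋} · A`. [folklore] -/
theorem bitsToNat_rhsF (tt y : List Bool) :
    bitsToNat (rhsF (boolPair tt y)) = 2 * 2 ^ ((fstP y).length / 8) * accCount tt y := by
  unfold rhsF
  rw [n8F_apply, accF_apply, addFn_boolPair, bitsToNat_encodeNat, Kannan.zerosFn_apply,
    TM2Pass.bitsToNat_zeros_append, bitsToNat_encodeNat]
  simp only [ones, List.length_replicate]
  ring

/-- `COUNT`: `2ⁿ (S + 2) ≤ 2 S A` (as "not `2 S A < 2ⁿ (S + 2)`"). [folklore] -/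
def COUNT : Language Bool := {z | cmpF z = (fun _ => [false]) z}

/-- `COUNT ∈ P`. [folklore] -/
theorem COUNT_mem_P : COUNT ∈ P := setOf_apply_eq_apply_mem_P cmpF_mem_FP (const_mem_FP _)

/-- Reading `COUNT`. [folklore] -/
theorem mem_COUNT_iff (tt y : List Bool) : boolPair tt y ∈ COUNT ↔
    2 ^ (fstP y).length * (2 ^ ((fstP y).length / 8) + 2) ≤ 2 * 2 ^ ((fstP y).length / 8) * accCount tt y := by
  rw [COUNT, memL_setOf]
  unfold cmpF
  rw [ltFn_boolPair, bitsToNat_rhsF, bitsToNat_lhsF]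
  simp

/-! ### The verifier -/

/-- **The verifier language of `ApproxTables 2^{⌊ℓ/8⌋}`.** [cite: KabanetsCai2000, §2] -/
def Ver : Language Bool := POW' ⊓ CLEAN' ⊓ SIZE' ⊓ COUNT

/-- **The verifier is polynomial time.** [cite: KabanetsCai2000, §2] -/
theorem Ver_mem_P : Ver ∈ P := inter_mem_P (inter_mem_P (inter_mem_P POW'_mem_P CLEAN'_mem_P) SIZE'_mem_P) COUNT_mem_P

/-- **The agreement count of a table against a program computing `g` is `#{v | g v = f v}`.** [folklore] -/
theorem accCount_truthTable {n : ℕ} (f g : (Fin n → Bool) → Bool) (y : List Bool) (hn : (fstP y).length = n)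
    (hD : ∀ v : Fin n → Bool, evalFn (boolPair (List.ofFn v) (sndP y)) = [g v]) :
    accCount (truthTable f) y = #{v : Fin n → Bool | g v = f v} := by
  classical
  unfold accCount
  rw [length_truthTable]
  -- reindex the rows by the points of the cube
  have hterm : ∀ i ∈ Finset.range (2 ^ n),
      (decide (((truthTable f).drop i).take 1 =
        evalFn (boolPair (List.ofFn (lowBits (fstP y).length i)) (sndP y)))).toNat =
      (decide (g (lowBits n i) = f (lowBits n i))).toNat := by
    intro i hi
    rw [Finset.mem_range] at hi
    rw [hn, hD, List.take_one_drop_eq_of_lt_length (by simpa using hi), List.get_eq_getElem, getElem_truthTable]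
    simp only [List.cons.injEq, and_true]
    by_cases h : g (lowBits n i) = f (lowBits n i)
    · simp [h]
    · simp [h, Ne.symm h]
  rw [Finset.sum_congr rfl hterm, Finset.card_eq_sum_ones, Finset.sum_filter]
  -- `i ↦ lowBits n i` is the enumeration `(boolFunEquivFin n).symm`
  rw [← Fin.sum_univ_eq_sum_range]
  refine Finset.sum_equiv (boolFunEquivFin n).symm (fun i => by simp) (fun i _ => ?_)
  rw [boolFunEquivFin_symm_apply]
  by_cases h : g (lowBits n i) = f (lowBits n i) <;> simp [h]

/-- **Soundness**: an accepted pair `⟨x, y⟩` has `x ∈ ApproxTables eighthExp` — `x` is a table of arity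
`n = |fstP y|` (`POW'`), the clean program (`CLEAN'`) computes some `C` over `B₂` of size
`≤ max (#TAB D) 1 ≤ 2^{⌊n/8⌋}` (Theorem R, `SIZE'`), and `COUNT` is the agreement threshold for `C`.
[cite: KabanetsCai2000, §2] -/
theorem sound (x y : List Bool) (h : boolPair x y ∈ Ver) : x ∈ ApproxTables eighthExp := by
  have hPOW := (mem_POW'_iff x y).1 h.1.1.1
  have hCLEAN := (mem_CLEAN'_iff x y).1 h.1.1.2
  have hSIZE := (mem_SIZE'_iff x y).1 h.1.2
  have hCOUNT := (mem_COUNT_iff x y).1 h.2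
  set n := (fstP y).length with hn
  set D := sndP y with hD
  set f : (Fin n → Bool) → Bool := ofTruthTable x hPOW with hf
  have htf : truthTable f = x := truthTable_ofTruthTable x hPOW
  rw [← htf]
  obtain ⟨C, hB, hsize, hC⟩ := exists_circuit_evalFn n D hCLEAN
  refine (truthTable_mem_ApproxTables_iff eighthExp f).2 ⟨C, hB, ?_, ?_⟩
  · exact hsize.trans (max_le hSIZE Nat.one_le_two_pow)
  · have hcount := accCount_truthTable f (fun v => C.eval v) y hn.symm hC
    rw [htf] at hcount
    rw [hcount] at hCOUNT
    simpa [eighthExp] using hCOUNT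

/-- **Completeness**: every table in `ApproxTables eighthExp` has the short accepted certificate
`⟨1ⁿ, progOf C⟩`, `C` a good approximator of size `≤ 2^{⌊n/8⌋} ≤ |x|`. [cite: KabanetsCai2000, §2] -/
theorem complete {n : ℕ} (f : (Fin n → Bool) → Bool) (hmem : truthTable f ∈ ApproxTables eighthExp) :
    ∃ y : List Bool, y.length ≤ wlen.eval (truthTable f).length ∧ boolPair (truthTable f) y ∈ Ver := by
  obtain ⟨C, hB, hsz, hle⟩ := (truthTable_mem_ApproxTables_iff eighthExp f).1 hmem
  have hsz' : C.size ≤ 2 ^ n := hsz.trans (Nat.pow_le_pow_right two_pos (Nat.div_le_self _ _))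
  have hnle : n ≤ 2 ^ n := (Nat.lt_two_pow_self).le
  refine ⟨boolPair (ones n) (progOf C), ?_, ?_⟩
  · have hl := length_progOf_le C
    simp only [length_boolPair, wlen_eval, ones, List.length_replicate, length_truthTable]
    have h2 : (C.size + 1) * (8 * (n + C.size) + 10) ≤ (2 ^ n + 1) * (8 * (2 ^ n + 2 ^ n) + 10) :=
      Nat.mul_le_mul (by omega) (by omega)
    nlinarith [h2, hl, hnle, Nat.zero_le ((2 ^ n) ^ 2)]
  · have hlen : (ones n).length = n := by simp [ones]
    have hD : ∀ v : Fin n → Bool, evalFn (boolPair (List.ofFn v) (sndP (boolPair (ones n) (progOf C)))) = [C.eval v] := by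
      intro v
      rw [sndP_boolPair, evalFn_boolPair, vmSpec_progOf C (arity_le_of_isOver hB)]
    refine ⟨⟨⟨?_, ?_⟩, ?_⟩, ?_⟩
    · exact (mem_POW'_iff _ _).2 (by rw [fstP_boolPair, hlen, length_truthTable])
    · exact (mem_CLEAN'_iff _ _).2 (by rw [sndP_boolPair, isClean_progOf])
    · refine (mem_SIZE'_iff _ _).2 ?_
      rw [sndP_boolPair, tabCount_progOf, fstP_boolPair, hlen]
      exact hsz
    · refine (mem_COUNT_iff _ _).2 ?_
      rw [accCount_truthTable f (fun v => C.eval v) _ (by rw [fstP_boolPair, hlen]) hD, fstP_boolPair, hlen]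
      exact hle

end ApproxVerif

open ApproxVerif in
/-- **`ApproxTables 2^{⌊ℓ/8⌋} ∈ NP`**: the tables admitting a `B₂`-circuit of size `≤ 2^{⌊ℓ/8⌋}` that
agrees on `≥ (1/2 + 2^{-⌊ℓ/8⌋}) 2^ℓ` inputs form an `NP` language (verifier `ApproxVerif.Ver ∈ P`,
witness-length bound `MCSPVerif.wlen`; the guess-and-check observation behind `MCSP ∈ NP` with an
agreement count). This is the `coNP`-ness of "`H_avg(f) ≥ 2^{⌊ℓ/8⌋}`" consumed by the Köbler–Schuler
certifier `AvgHardTables.exists_avgCertifier_eighthExp`.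
[cite: KabanetsCai2000, §2] [cite: Hirahara2021, Lemma 3.4 (proof sketch, item 2)] -/
theorem ApproxTables_eighthExp_mem_NP : ApproxTables eighthExp ∈ NP := by
  refine ⟨ApproxVerif.Ver, ApproxVerif.Ver_mem_P, wlen, fun x => ⟨fun hx => ?_, ?_⟩⟩
  · obtain ⟨n, f, rfl, hC⟩ := hx
    exact ApproxVerif.complete f ⟨n, f, rfl, hC⟩
  · rintro ⟨y, -, hy⟩
    exact ApproxVerif.sound x y hy

/-- **Köbler–Schuler certified average-case hardness under `coNP × {U} ⊆ Avg¹_{1-n^{-c}} P`**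
(unconditional form of `AvgHardTables.exists_avgCertifier_eighthExp`): a polynomial-time `A(w; 1ⁿ)`,
`c` and `ℓ₀` such that every accepted table `A(tt(f); 1^{2^ℓ}) = 1` has `H_avg(f) ≥ 2^{⌊ℓ/8⌋}`, a
uniformly random table of length `2^ℓ` (`ℓ ≥ ℓ₀`) is accepted with probability `≥ 1/(2 (2^ℓ)^c)`, and for
every `ℓ ≥ ℓ₀` some `ℓ`-variable function is accepted. [Hirahara 2021 (ECCC TR21-058), Lemma 3.4, proof
sketch, item 2 (p. 20); Köbler–Schuler 2004] [cite: Hirahara2021, Lemma 3.4 (proof sketch, item 2)] -/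
theorem exists_avgCertifier_of_uniform
    (hU : ∃ c : ℕ, distClass coNP {uniformEnsemble} ⊆ Avg1DeltaP fun n => 1 - 1 / (n : ℝ) ^ c) :
    ∃ (A : List Bool → ℕ → Bool) (c ℓ₀ : ℕ),
      PolyTimeComputable paramEnc encodeBool (Function.uncurry A) ∧
      (∀ (ℓ : ℕ) (f : (Fin ℓ → Bool) → Bool), A (truthTable f) (2 ^ ℓ) = true →
        AvgHardAtLeast f ((2 : ℝ) ^ (ℓ / 8))) ∧
      (∀ ℓ : ℕ, ℓ₀ ≤ ℓ → 1 / (2 * ((2 : ℝ) ^ ℓ) ^ c) ≤ uniformProb (2 ^ ℓ) {w | A w (2 ^ ℓ) = true}) ∧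
      ∀ ℓ : ℕ, ℓ₀ ≤ ℓ → ∃ f : (Fin ℓ → Bool) → Bool, A (truthTable f) (2 ^ ℓ) = true :=
  exists_avgCertifier_eighthExp hU ApproxTables_eighthExp_mem_NP

/-- **The same under Hirahara's hypothesis `coNP × {U, T} ⊆ Avg¹_{1-n^{-c}} P`** (the hypothesis of
`Hirahara2021_UP_searchUHS_of_Avg1P`). [cite: Hirahara2021, Lemma 3.4 (proof sketch, item 2)] -/
theorem Hirahara2021_exists_avgCertifier_of_Avg1P
    (hyp : ∃ c : ℕ, distClass coNP {uniformEnsemble, tallyEnsemble} ⊆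
      Avg1DeltaP fun n => 1 - 1 / (n : ℝ) ^ c) :
    ∃ (A : List Bool → ℕ → Bool) (c ℓ₀ : ℕ),
      PolyTimeComputable paramEnc encodeBool (Function.uncurry A) ∧
      (∀ (ℓ : ℕ) (f : (Fin ℓ → Bool) → Bool), A (truthTable f) (2 ^ ℓ) = true →
        AvgHardAtLeast f ((2 : ℝ) ^ (ℓ / 8))) ∧
      (∀ ℓ : ℕ, ℓ₀ ≤ ℓ → 1 / (2 * ((2 : ℝ) ^ ℓ) ^ c) ≤ uniformProb (2 ^ ℓ) {w | A w (2 ^ ℓ) = true}) ∧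
      ∀ ℓ : ℕ, ℓ₀ ≤ ℓ → ∃ f : (Fin ℓ → Bool) → Bool, A (truthTable f) (2 ^ ℓ) = true :=
  exists_avgCertifier_of_uniform (distClass_coNP_uniform_subset_Avg1DeltaP_of_weak hyp)

end Literature.Computability.MetaComplexity

end
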